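import Summits.CriticalPhenomena.PercolationContinuityZ3.Theorems.PercNearOneGluingNoHeavyLowerTailSahiC3ThreePointTableDn
import Summits.CriticalPhenomena.PercolationContinuityZ3.Theorems.PercNearOneGluingNoHeavyLowerTailM3LabelingPattern
import Summits.CriticalPhenomena.PercolationContinuityZ3.Theorems.PercNearOneGluingNoHeavyLowerTailThreePointLBSwitching
import Summits.CriticalPhenomena.PercolationContinuityZ3.Theorems.PercNearOneGluingNoHeavyLowerTailTIncSwitching
import Literature.Combinatorics.Sahi2008.Indicators
import Literature.Combinatorics.Sahi2008.ProvedCases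
import Literature.Probability.LatticeModels.ProdBernoulliIndependence
import Mathlib.Tactic.FinCases
import HarnessLib

/-!
# `NoHeavyLowerTail` (stmt-CriticalPhenomena-4575) — **Sahi's `C₃` holds on the whole three-point connectivity algebra of bond
# percolation on every finite graph**: the law of the connection pattern of `(a,b,c)` — a probability weight on the diamond `M₃` — is
# Sahi-positive of order `3` (IV: measure level)

Support file (prover prim-sahi-p2 gen 3; `--supports stmt-CriticalPhenomena-4575`).  No named facts, no sorries.

**Theorem** (`sahiPositive_three_patternLaw`).  For `μ = prodBernoulli w` on the edges of a finite graph and vertices `a b c`, let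
`π = pattern a b c : BondConfig V → M₃` be the connection pattern (`bot = a|b|c`, `pet 0 = ab|c`, `pet 1 = ac|b`, `pet 2 = a|bc`, `top = abc`;
file `…M3LabelingPattern`) and `cell w π : M₃ → ℝ` its law.  Then `SahiPositive (cell w π) 3`: for all nonnegative monotone
`f g h : M₃ → ℝ`, `E₃(f,g,h) ≥ 0` [Sahi2008, Conj. 5 at `n = 3`; Kahn2022, Conj. 5] — equivalently (layer cake, `sahiPositive_iff_indicators`)
Sahi's `E₃ ≥ 0` for EVERY triple of increasing events of the three-point connectivity type; `sahiE_three_nonneg_of_lowerSets` is the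
decreasing version (indicators of lower sets).  CONTRAST: for a general FKG weight on `M₃` the same statement is FALSE (`…SahiC3DiamondObstruction`,
`E₃ = −53/1728`); percolation pattern laws are special.

**Proof.**  prim-ineq-prove-2's classification (MEMO-6): of the `120 + 120` triples of up-sets / down-sets of `M₃`, `119 + 119` are exact
nonnegative combinations of `cell × Harris slack` (replayed by reflection, files II–III: `up_all`, `dn_all`), and the two irreducible ones are
`T_inc` (`TIncSwitching.tInc_prodBernoulli`, prim-e3grp-switch-1) and `3PT-LB` (`ThreePointLB.threePointLB_prodBernoulli`, prim-lit-2 /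
prim-cert-2).  Here: Harris for pattern events (`prodBernoulli_harris`, monotonicity of `pattern`), the cell dictionary `cell_pattern_eq`,
`cell_sum`, and the case analysis of an upper set of `M₃` (`∅`, everything, or `{top} ∪ pets`).
-/

noncomputable section

namespace Summit.CriticalPhenomena.PercolationContinuityZ3.Theorems

namespace SahiC3ThreePoint

open MeasureTheory Literature.Probability.Percolation Literature.Probability.LatticeModels
open Literature.Combinatorics.Sahi2008

/-! ### Up-sets and down-sets of `M₃` as finsets -/

/-- Membership in the up-set `u(j) = {top} ∪ {pet i : j_i}`. [this work] -/
def uMem (j0 j1 j2 : Bool) : M3 → Bool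
  | .top => true
  | .bot => false
  | .pet i => if i = 0 then j0 else if i = 1 then j1 else j2

/-- Membership in the down-set `d(j) = {bot} ∪ {pet i : j_i}`. [this work] -/
def dMem (j0 j1 j2 : Bool) : M3 → Bool
  | .top => false
  | .bot => true
  | .pet i => if i = 0 then j0 else if i = 1 then j1 else j2

/-- The up-set `u(j)` as a finset. [this work] -/
def uFin (j0 j1 j2 : Bool) : Finset M3 := Finset.univ.filter fun x => uMem j0 j1 j2 x = true

/-- The down-set `d(j)` as a finset. [this work] -/
def dFin (j0 j1 j2 : Bool) : Finset M3 := Finset.univ.filter fun x => dMem j0 j1 j2 x = true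

/-- Sum over the five elements of `M₃`. [folklore] -/
theorem sum_M3 (f : M3 → ℝ) : ∑ x, f x = f .bot + f (.pet 0) + f (.pet 1) + f (.pet 2) + f .top := by
  rw [show (Finset.univ : Finset M3) = {M3.bot, M3.pet 0, M3.pet 1, M3.pet 2, M3.top} from rfl]
  simp only [Finset.sum_insert, Finset.mem_insert, Finset.mem_singleton, reduceCtorEq, M3.pet.injEq,
    Fin.reduceEq, or_self, not_false_eq_true, Finset.sum_singleton]
  ring

/-- `mass μ u(j) = mUp`. [this work] -/
theorem mass_uFin (μ : M3 → ℝ) (j0 j1 j2 : Bool) :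
    mass μ (uFin j0 j1 j2) = mUp (μ .top) (μ (.pet 0)) (μ (.pet 1)) (μ (.pet 2)) j0 j1 j2 := by
  unfold mass uFin
  rw [Finset.sum_filter, sum_M3]
  cases j0 <;> cases j1 <;> cases j2 <;> simp [uMem, mUp] <;> ring

/-- `mass μ d(j) = mDn`. [this work] -/
theorem mass_dFin (μ : M3 → ℝ) (j0 j1 j2 : Bool) :
    mass μ (dFin j0 j1 j2) = mDn (μ .bot) (μ (.pet 0)) (μ (.pet 1)) (μ (.pet 2)) j0 j1 j2 := by
  unfold mass dFin
  rw [Finset.sum_filter, sum_M3]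
  cases j0 <;> cases j1 <;> cases j2 <;> simp [dMem, mDn]

/-- Intersections of up-sets. [this work] -/
theorem uFin_inter (j0 j1 j2 k0 k1 k2 : Bool) :
    uFin j0 j1 j2 ∩ uFin k0 k1 k2 = uFin (j0 && k0) (j1 && k1) (j2 && k2) := by
  ext x
  simp only [uFin, Finset.mem_inter, Finset.mem_filter, Finset.mem_univ, true_and]
  rcases x with _ | i | _
  · simp [uMem]
  · fin_cases i <;> simp [uMem]
  · simp [uMem]

/-- Intersections of down-sets. [this work] -/
theorem dFin_inter (j0 j1 j2 k0 k1 k2 : Bool) :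
    dFin j0 j1 j2 ∩ dFin k0 k1 k2 = dFin (j0 && k0) (j1 && k1) (j2 && k2) := by
  ext x
  simp only [dFin, Finset.mem_inter, Finset.mem_filter, Finset.mem_univ, true_and]
  rcases x with _ | i | _
  · simp [dMem]
  · fin_cases i <;> simp [dMem]
  · simp [dMem]

/-- `u(j)` is an upper set. [this work] -/
theorem isUpperSet_uFin (j0 j1 j2 : Bool) : IsUpperSet ((uFin j0 j1 j2 : Finset M3) : Set M3) := by
  intro x y hxy hx
  simp only [Finset.coe_filter, uFin, Finset.mem_univ, true_and, Set.mem_setOf_eq] at hx ⊢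
  rcases x with _ | i | _ <;> rcases y with _ | i' | _ <;> simp_all [uMem]

/-- `d(j)` is a lower set. [this work] -/
theorem isLowerSet_dFin (j0 j1 j2 : Bool) : IsLowerSet ((dFin j0 j1 j2 : Finset M3) : Set M3) := by
  intro x y hyx hx
  simp only [Finset.coe_filter, dFin, Finset.mem_univ, true_and, Set.mem_setOf_eq] at hx ⊢
  rcases x with _ | i | _ <;> rcases y with _ | i' | _ <;> simp_all [dMem]

/-- **An upper set of `M₃` is `∅`, everything, or `{top} ∪ pets`.** [folklore] -/
theorem upper_cases (U : Finset M3) (hU : IsUpperSet ((U : Finset M3) : Set M3)) :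
    U = ∅ ∨ U = Finset.univ ∨ U = uFin (decide (M3.pet 0 ∈ U)) (decide (M3.pet 1 ∈ U)) (decide (M3.pet 2 ∈ U)) := by
  classical
  by_cases hb : M3.bot ∈ U
  · right; left
    ext x; simp only [Finset.mem_univ, iff_true]
    exact hU (M3.bot_le x) hb
  by_cases ht : M3.top ∈ U
  · right; right
    ext x
    simp only [uFin, Finset.mem_filter, Finset.mem_univ, true_and]
    rcases x with _ | i | _
    · simp [uMem, hb]
    · fin_cases i <;> simp [uMem]
    · simp [uMem, ht]
  · left
    ext x
    simp only [Finset.notMem_empty, iff_false]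
    intro hx
    exact ht (hU (M3.le_top x) hx)

/-- **A lower set of `M₃` is `∅`, everything, or `{bot} ∪ pets.** [folklore] -/
theorem lower_cases (U : Finset M3) (hU : IsLowerSet ((U : Finset M3) : Set M3)) :
    U = ∅ ∨ U = Finset.univ ∨ U = dFin (decide (M3.pet 0 ∈ U)) (decide (M3.pet 1 ∈ U)) (decide (M3.pet 2 ∈ U)) := by
  classical
  by_cases ht : M3.top ∈ U
  · right; left
    ext x; simp only [Finset.mem_univ, iff_true]
    exact hU (M3.le_top x) ht
  by_cases hb : M3.bot ∈ U
  · right; right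
    ext x
    simp only [dFin, Finset.mem_filter, Finset.mem_univ, true_and]
    rcases x with _ | i | _
    · simp [dMem, hb]
    · fin_cases i <;> simp [dMem]
    · simp [dMem, ht]
  · left
    ext x
    simp only [Finset.notMem_empty, iff_false]
    intro hx
    exact hb (hU (M3.bot_le x) hx)

/-! ### The pattern law of a finite weighted graph satisfies the hypotheses -/

section Law

variable {V : Type*} [Fintype V] (w : Sym2 V → unitInterval) (a b c : V)

/-- The measure of a pattern event is the mass of the cell law. [this work] -/
theorem real_pattern_preimage (S : Finset M3) :
    (prodBernoulli w).real (pattern a b c ⁻¹' (S : Set M3)) = mass (cell w (pattern a b c)) S := by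
  classical
  have hdisj : (↑S : Set M3).PairwiseDisjoint (fun x => pattern a b c ⁻¹' ({x} : Set M3)) :=
    fun x _ y _ hxy => Set.disjoint_left.2 fun ω (h1 : pattern a b c ω = x) (h2 : pattern a b c ω = y) =>
      hxy (h1.symm.trans h2)
  have hmeas : ∀ x ∈ S, MeasurableSet (pattern a b c ⁻¹' ({x} : Set M3)) :=
    fun x _ => ((pattern_detBy a b c).determinedBy_preimage {x}).measurableSet_of_finset
  have hU : (⋃ x ∈ S, pattern a b c ⁻¹' ({x} : Set M3)) = pattern a b c ⁻¹' (S : Set M3) := by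
    ext ω; simp
  rw [← hU, measureReal_biUnion_finset hdisj hmeas]
  rfl

/-- **Harris for two up-set pattern events**, in mass form. [this work] -/
theorem harris_uFin (j0 j1 j2 k0 k1 k2 : Bool) :
    mass (cell w (pattern a b c)) (uFin j0 j1 j2) * mass (cell w (pattern a b c)) (uFin k0 k1 k2) ≤
      mass (cell w (pattern a b c)) (uFin (j0 && k0) (j1 && k1) (j2 && k2)) := by
  have hA : IsUpperSet (pattern a b c ⁻¹' ((uFin j0 j1 j2 : Finset M3) : Set M3)) :=
    (isUpperSet_uFin j0 j1 j2).preimage (pattern_mono a b c)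
  have hB : IsUpperSet (pattern a b c ⁻¹' ((uFin k0 k1 k2 : Finset M3) : Set M3)) :=
    (isUpperSet_uFin k0 k1 k2).preimage (pattern_mono a b c)
  have hAm : MeasurableSet (pattern a b c ⁻¹' ((uFin j0 j1 j2 : Finset M3) : Set M3)) :=
    ((pattern_detBy a b c).determinedBy_preimage _).measurableSet_of_finset
  have hBm : MeasurableSet (pattern a b c ⁻¹' ((uFin k0 k1 k2 : Finset M3) : Set M3)) :=
    ((pattern_detBy a b c).determinedBy_preimage _).measurableSet_of_finset
  have h := prodBernoulli_harris w hA hB hAm hBm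
  rw [← Set.preimage_inter, ← Finset.coe_inter, uFin_inter, real_pattern_preimage, real_pattern_preimage,
    real_pattern_preimage] at h
  exact h

/-- **Harris for two down-set pattern events**, in mass form. [this work] -/
theorem harris_dFin (j0 j1 j2 k0 k1 k2 : Bool) :
    mass (cell w (pattern a b c)) (dFin j0 j1 j2) * mass (cell w (pattern a b c)) (dFin k0 k1 k2) ≤
      mass (cell w (pattern a b c)) (dFin (j0 && k0) (j1 && k1) (j2 && k2)) := by
  have hA : IsLowerSet (pattern a b c ⁻¹' ((dFin j0 j1 j2 : Finset M3) : Set M3)) :=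
    (isLowerSet_dFin j0 j1 j2).preimage (pattern_mono a b c)
  have hB : IsLowerSet (pattern a b c ⁻¹' ((dFin k0 k1 k2 : Finset M3) : Set M3)) :=
    (isLowerSet_dFin k0 k1 k2).preimage (pattern_mono a b c)
  have hAm : MeasurableSet (pattern a b c ⁻¹' ((dFin j0 j1 j2 : Finset M3) : Set M3)) :=
    ((pattern_detBy a b c).determinedBy_preimage _).measurableSet_of_finset
  have hBm : MeasurableSet (pattern a b c ⁻¹' ((dFin k0 k1 k2 : Finset M3) : Set M3)) :=
    ((pattern_detBy a b c).determinedBy_preimage _).measurableSet_of_finset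
  have h := prodBernoulli_harris_lower w hA hB hAm hBm
  rw [← Set.preimage_inter, ← Finset.coe_inter, dFin_inter, real_pattern_preimage, real_pattern_preimage,
    real_pattern_preimage] at h
  exact h

/-- The cells of the pattern law sum to one (in the order `top, pet 0, pet 1, pet 2, bot`). [this work] -/
theorem cells_sum_one :
    cell w (pattern a b c) .top + cell w (pattern a b c) (.pet 0) + cell w (pattern a b c) (.pet 1) +
      cell w (pattern a b c) (.pet 2) + cell w (pattern a b c) .bot = 1 := by
  have h := cell_sum w (pattern_detBy a b c)
  linarith

/-- `mass` of everything is `1`. [this work] -/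
theorem mass_univ_pattern : mass (cell w (pattern a b c)) Finset.univ = 1 := by
  rw [mass_univ, sum_M3]
  have h := cells_sum_one w a b c
  linarith

/-- `mass` of nothing is `0`. [folklore] -/
theorem mass_empty' (μ : M3 → ℝ) : mass μ ∅ = 0 := by simp [mass]

/-- The irreducible increasing fact: homogenised `T_inc ≥ 0` for the pattern cells (`TIncSwitching.tInc_prodBernoulli`). [this work] -/
theorem tinc_cells :
    0 ≤ (cell w (pattern a b c) .top + cell w (pattern a b c) (.pet 0) + cell w (pattern a b c) (.pet 1) +
        cell w (pattern a b c) (.pet 2) + cell w (pattern a b c) .bot + cell w (pattern a b c) .bot) *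
        (cell w (pattern a b c) .bot * cell w (pattern a b c) .top -
          (cell w (pattern a b c) (.pet 0) * cell w (pattern a b c) (.pet 1) +
            cell w (pattern a b c) (.pet 0) * cell w (pattern a b c) (.pet 2) +
            cell w (pattern a b c) (.pet 1) * cell w (pattern a b c) (.pet 2))) -
      cell w (pattern a b c) (.pet 0) * cell w (pattern a b c) (.pet 1) * cell w (pattern a b c) (.pet 2) := by
  have h := TIncSwitching.tInc_prodBernoulli w a b c
  obtain ⟨eT, e0, e1, e2, eB⟩ := cell_pattern_eq w a b c
  rw [← eT, ← e0, ← e1, ← e2, ← eB] at h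
  rw [cells_sum_one]
  nlinarith [h]

/-- The irreducible decreasing fact: homogenised `3PT-LB ≥ 0` for the pattern cells (`ThreePointLB.threePointLB_prodBernoulli`). [this work] -/
theorem tdec_cells :
    0 ≤ (cell w (pattern a b c) .top + cell w (pattern a b c) (.pet 0) + cell w (pattern a b c) (.pet 1) +
        cell w (pattern a b c) (.pet 2) + cell w (pattern a b c) .bot + cell w (pattern a b c) .top) *
        (cell w (pattern a b c) .bot * cell w (pattern a b c) .top -
          (cell w (pattern a b c) (.pet 0) * cell w (pattern a b c) (.pet 1) +
            cell w (pattern a b c) (.pet 0) * cell w (pattern a b c) (.pet 2) +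
            cell w (pattern a b c) (.pet 1) * cell w (pattern a b c) (.pet 2))) -
      cell w (pattern a b c) (.pet 0) * cell w (pattern a b c) (.pet 1) * cell w (pattern a b c) (.pet 2) := by
  have h := ThreePointLB.threePointLB_prodBernoulli w a b c
  obtain ⟨eT, e0, e1, e2, eB⟩ := cell_pattern_eq w a b c
  rw [← eT, ← e0, ← e1, ← e2, ← eB] at h
  rw [cells_sum_one]
  nlinarith [h]

/-- `E₃ ≥ 0` for every ordered triple of nonempty proper up-sets of the pattern, in mass form. [this work] -/
theorem e3_uFin_nonneg (j0 j1 j2 k0 k1 k2 l0 l1 l2 : Bool) :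
    0 ≤ 2 * mass (cell w (pattern a b c)) (uFin (j0 && k0 && l0) (j1 && k1 && l1) (j2 && k2 && l2)) +
        mass (cell w (pattern a b c)) (uFin j0 j1 j2) * mass (cell w (pattern a b c)) (uFin k0 k1 k2) *
          mass (cell w (pattern a b c)) (uFin l0 l1 l2) -
        (mass (cell w (pattern a b c)) (uFin j0 j1 j2) * mass (cell w (pattern a b c)) (uFin (k0 && l0) (k1 && l1) (k2 && l2)) +
          mass (cell w (pattern a b c)) (uFin k0 k1 k2) * mass (cell w (pattern a b c)) (uFin (j0 && l0) (j1 && l1) (j2 && l2)) +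
          mass (cell w (pattern a b c)) (uFin l0 l1 l2) * mass (cell w (pattern a b c)) (uFin (j0 && k0) (j1 && k1) (j2 && k2))) := by
  set cw := cell w (pattern a b c) with hcw
  have hs := cells_sum_one w a b c
  have hH : ∀ j0 j1 j2 k0 k1 k2 : Bool, mUp (cw .top) (cw (.pet 0)) (cw (.pet 1)) (cw (.pet 2)) j0 j1 j2 *
      mUp (cw .top) (cw (.pet 0)) (cw (.pet 1)) (cw (.pet 2)) k0 k1 k2 ≤
      (cw .top + cw (.pet 0) + cw (.pet 1) + cw (.pet 2) + cw .bot) *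
        mUp (cw .top) (cw (.pet 0)) (cw (.pet 1)) (cw (.pet 2)) (j0 && k0) (j1 && k1) (j2 && k2) := by
    intro j0 j1 j2 k0 k1 k2
    rw [hs, one_mul, ← mass_uFin, ← mass_uFin, ← mass_uFin]
    exact harris_uFin w a b c j0 j1 j2 k0 k1 k2
  have h := up_all (cell_nonneg w _ .top) (cell_nonneg w _ (.pet 0)) (cell_nonneg w _ (.pet 1)) (cell_nonneg w _ (.pet 2))
    (cell_nonneg w _ .bot) hH (tinc_cells w a b c) j0 j1 j2 k0 k1 k2 l0 l1 l2
  simp only [E3u, e3h] at h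
  rw [hs, ← mass_uFin, ← mass_uFin, ← mass_uFin, ← mass_uFin, ← mass_uFin, ← mass_uFin, ← mass_uFin] at h
  linarith

/-- `E₃ ≥ 0` for every ordered triple of nonempty proper down-sets of the pattern, in mass form. [this work] -/
theorem e3_dFin_nonneg (j0 j1 j2 k0 k1 k2 l0 l1 l2 : Bool) :
    0 ≤ 2 * mass (cell w (pattern a b c)) (dFin (j0 && k0 && l0) (j1 && k1 && l1) (j2 && k2 && l2)) +
        mass (cell w (pattern a b c)) (dFin j0 j1 j2) * mass (cell w (pattern a b c)) (dFin k0 k1 k2) *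
          mass (cell w (pattern a b c)) (dFin l0 l1 l2) -
        (mass (cell w (pattern a b c)) (dFin j0 j1 j2) * mass (cell w (pattern a b c)) (dFin (k0 && l0) (k1 && l1) (k2 && l2)) +
          mass (cell w (pattern a b c)) (dFin k0 k1 k2) * mass (cell w (pattern a b c)) (dFin (j0 && l0) (j1 && l1) (j2 && l2)) +
          mass (cell w (pattern a b c)) (dFin l0 l1 l2) * mass (cell w (pattern a b c)) (dFin (j0 && k0) (j1 && k1) (j2 && k2))) := by
  set cw := cell w (pattern a b c) with hcw
  have hs := cells_sum_one w a b c
  have hH : ∀ j0 j1 j2 k0 k1 k2 : Bool, mDn (cw .bot) (cw (.pet 0)) (cw (.pet 1)) (cw (.pet 2)) j0 j1 j2 *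
      mDn (cw .bot) (cw (.pet 0)) (cw (.pet 1)) (cw (.pet 2)) k0 k1 k2 ≤
      (cw .top + cw (.pet 0) + cw (.pet 1) + cw (.pet 2) + cw .bot) *
        mDn (cw .bot) (cw (.pet 0)) (cw (.pet 1)) (cw (.pet 2)) (j0 && k0) (j1 && k1) (j2 && k2) := by
    intro j0 j1 j2 k0 k1 k2
    rw [hs, one_mul, ← mass_dFin, ← mass_dFin, ← mass_dFin]
    exact harris_dFin w a b c j0 j1 j2 k0 k1 k2
  have h := dn_all (cell_nonneg w _ .top) (cell_nonneg w _ (.pet 0)) (cell_nonneg w _ (.pet 1)) (cell_nonneg w _ (.pet 2))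
    (cell_nonneg w _ .bot) hH (tdec_cells w a b c) j0 j1 j2 k0 k1 k2 l0 l1 l2
  simp only [E3d, e3h] at h
  rw [hs, ← mass_dFin, ← mass_dFin, ← mass_dFin, ← mass_dFin, ← mass_dFin, ← mass_dFin, ← mass_dFin] at h
  linarith

/-! ### The theorem: the pattern law is Sahi-positive of order 3 -/

/-- **Sahi's `C₃` on the three-point connectivity algebra (increasing form).**  For every finite weighted graph and vertices `a b c`,
the law of the connection pattern `pattern a b c` (a probability weight on the diamond `M₃`) is Sahi-positive of order `3`:
`E₃(f,g,h) ≥ 0` for all nonnegative monotone `f g h : M₃ → ℝ` — i.e. for every triple of increasing events of the three-point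
connectivity type [Sahi2008, Conj. 5 (n = 3); Kahn2022, Conj. 5; LiebSahi2021, Conj. 1.1], although `C₃` fails for general FKG
weights on `M₃` (`…SahiC3DiamondObstruction`). [this work] -/
theorem sahiPositive_three_patternLaw : SahiPositive (cell w (pattern a b c)) 3 := by
  classical
  rw [sahiPositive_iff_indicators]
  intro U hU
  rw [sahiE_three_apply]
  simp only [setInd_mul, ex_setInd]
  have hm0 : mass (cell w (pattern a b c)) ∅ = 0 := mass_empty' _
  have hm1 : mass (cell w (pattern a b c)) Finset.univ = 1 := mass_univ_pattern w a b c
  have hH := harris_uFin w a b c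
  have hE := e3_uFin_nonneg w a b c
  rcases upper_cases (U 0) (hU 0) with h0 | h0 | h0 <;>
  rcases upper_cases (U 1) (hU 1) with h1 | h1 | h1 <;>
  rcases upper_cases (U 2) (hU 2) with h2 | h2 | h2 <;>
  rw [h0, h1, h2] <;>
  simp only [Finset.empty_inter, Finset.inter_empty, Finset.univ_inter, Finset.inter_univ, uFin_inter, hm0, hm1,
    mul_zero, zero_mul, mul_one, one_mul, add_zero, sub_zero] <;>
  first
  | exact le_refl _
  | nlinarith [hH (decide (M3.pet 0 ∈ U 1)) (decide (M3.pet 1 ∈ U 1)) (decide (M3.pet 2 ∈ U 1))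
      (decide (M3.pet 0 ∈ U 2)) (decide (M3.pet 1 ∈ U 2)) (decide (M3.pet 2 ∈ U 2)),
      hH (decide (M3.pet 0 ∈ U 0)) (decide (M3.pet 1 ∈ U 0)) (decide (M3.pet 2 ∈ U 0))
      (decide (M3.pet 0 ∈ U 2)) (decide (M3.pet 1 ∈ U 2)) (decide (M3.pet 2 ∈ U 2)),
      hH (decide (M3.pet 0 ∈ U 0)) (decide (M3.pet 1 ∈ U 0)) (decide (M3.pet 2 ∈ U 0))
      (decide (M3.pet 0 ∈ U 1)) (decide (M3.pet 1 ∈ U 1)) (decide (M3.pet 2 ∈ U 1)),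
      hE (decide (M3.pet 0 ∈ U 0)) (decide (M3.pet 1 ∈ U 0)) (decide (M3.pet 2 ∈ U 0))
      (decide (M3.pet 0 ∈ U 1)) (decide (M3.pet 1 ∈ U 1)) (decide (M3.pet 2 ∈ U 1))
      (decide (M3.pet 0 ∈ U 2)) (decide (M3.pet 1 ∈ U 2)) (decide (M3.pet 2 ∈ U 2))]

/-- **Sahi's `C₃` on the three-point connectivity algebra (decreasing form)**: `E₃ ≥ 0` for every triple of DECREASING events
of the three-point connectivity type, i.e. for the indicators of any three lower sets of `M₃` under the pattern law (irreducible case: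
`3PT-LB`); by trilinearity and layer cake this is `E₃(f,g,h) ≥ 0` for nonnegative antitone `f g h`. [this work] -/
theorem sahiE_three_nonneg_of_lowerSets (U : Fin 3 → Finset M3) (hU : ∀ i, IsLowerSet ((U i : Finset M3) : Set M3)) :
    0 ≤ sahiE (cell w (pattern a b c)) 3 (fun i => setInd (U i)) := by
  classical
  rw [sahiE_three_apply]
  simp only [setInd_mul, ex_setInd]
  have hm0 : mass (cell w (pattern a b c)) ∅ = 0 := mass_empty' _
  have hm1 : mass (cell w (pattern a b c)) Finset.univ = 1 := mass_univ_pattern w a b c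
  have hH := harris_dFin w a b c
  have hE := e3_dFin_nonneg w a b c
  rcases lower_cases (U 0) (hU 0) with h0 | h0 | h0 <;>
  rcases lower_cases (U 1) (hU 1) with h1 | h1 | h1 <;>
  rcases lower_cases (U 2) (hU 2) with h2 | h2 | h2 <;>
  rw [h0, h1, h2] <;>
  simp only [Finset.empty_inter, Finset.inter_empty, Finset.univ_inter, Finset.inter_univ, dFin_inter, hm0, hm1,
    mul_zero, zero_mul, mul_one, one_mul, add_zero, sub_zero] <;>
  first
  | exact le_refl _
  | nlinarith [hH (decide (M3.pet 0 ∈ U 1)) (decide (M3.pet 1 ∈ U 1)) (decide (M3.pet 2 ∈ U 1))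
      (decide (M3.pet 0 ∈ U 2)) (decide (M3.pet 1 ∈ U 2)) (decide (M3.pet 2 ∈ U 2)),
      hH (decide (M3.pet 0 ∈ U 0)) (decide (M3.pet 1 ∈ U 0)) (decide (M3.pet 2 ∈ U 0))
      (decide (M3.pet 0 ∈ U 2)) (decide (M3.pet 1 ∈ U 2)) (decide (M3.pet 2 ∈ U 2)),
      hH (decide (M3.pet 0 ∈ U 0)) (decide (M3.pet 1 ∈ U 0)) (decide (M3.pet 2 ∈ U 0))
      (decide (M3.pet 0 ∈ U 1)) (decide (M3.pet 1 ∈ U 1)) (decide (M3.pet 2 ∈ U 1)),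
      hE (decide (M3.pet 0 ∈ U 0)) (decide (M3.pet 1 ∈ U 0)) (decide (M3.pet 2 ∈ U 0))
      (decide (M3.pet 0 ∈ U 1)) (decide (M3.pet 1 ∈ U 1)) (decide (M3.pet 2 ∈ U 1))
      (decide (M3.pet 0 ∈ U 2)) (decide (M3.pet 1 ∈ U 2)) (decide (M3.pet 2 ∈ U 2))]

/-- The increasing form as an explicit indicator statement: `E₃ ≥ 0` for the indicators of any three upper sets of `M₃` under the
pattern law (every triple of INCREASING events of the three-point connectivity type). [this work] -/
theorem sahiE_three_nonneg_of_upperSets (U : Fin 3 → Finset M3) (hU : ∀ i, IsUpperSet ((U i : Finset M3) : Set M3)) :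
    0 ≤ sahiE (cell w (pattern a b c)) 3 (fun i => setInd (U i)) := by
  classical
  exact (sahiPositive_iff_indicators _ 3).1 (sahiPositive_three_patternLaw w a b c) U hU

end Law

end SahiC3ThreePoint

end Summit.CriticalPhenomena.PercolationContinuityZ3.Theorems

end
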